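import Summits.BirchSwinnertonDyer.BirchSwinnertonDyer.Theorems.ManinLocalTwoThreeBlindFamilyTorsion
import Summits.BirchSwinnertonDyer.BirchSwinnertonDyer.Theorems.Rank2ObservatoryTamagawaExactCert
import Summits.BirchSwinnertonDyer.BirchSwinnertonDyer.Theorems.Rank2ObservatoryTamagawaIzeroLocal
import HarnessLib
import HarnessLib.Audit.Tags

/-!
# E-an-103♯ `BlindFamilyTamagawaLaw` IS A THEOREM: `∏_ℓ c_ℓ(E′_m) = 2 · (3 if m ≡ 1 (8), else 1)` for odd `m`,
# `m² + 4` prime — and with E-an-103♭ the support row E-an-103 `BlindFamilyLocalTerms` BY NAME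
# (cell `bsd-f2-manin`, crux C2 `ManinOddAtFour` stmt-BirchSwinnertonDyer-22967 — the blind TAME residual of line
# `kato_shift_two` IS this family; an's THEOREM TARGET of `BlindFamilyBSDTwo.lean`, MEMO-an §65; C2/C3 LEAD p1 gen 8)

Summit `BirchSwinnertonDyer`, route `ManinLocalTwoThree`.  The typed row E-an-103♯
`Summit.BirchSwinnertonDyer.Rank1Residual.ManinAdditive.BlindFamilyDescent.BlindFamilyTamagawaLaw` («PAPER THEOREM —
Tate's algorithm on `[0, −2m, 0, m² + 4, 0]`; theorem target; nothing asserted», refuter-1 §R68 SURVIVES incl. `m = ±1`)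
is discharged here BY NAME, SYMBOLICALLY IN `m` (no kernel certificate: the rank-2 observatory's integer-equation
layer `index_IVstar_intCast_eq_one/three`, `index_Istar_zero_intCast_eq`, `tam_eq_index_intModel`,
`finprod_eq_prod_map_pl` is fed hand-proved divisibilities):

* `Δ(E′_m) = −2⁸ p²`, `c₄ = 2⁴ (m² − 12)`, `p = m² + 4` odd; `E′_m` is globally minimal (PART A).
* At `p`: `p ∤ c₄` (else `p ∣ 2⁸`), `p² ∥ Δ` ⟹ multiplicative, `ord_p Δ_min = 2`, so `c_p = 2` whether split
  (`c = ord Δ`) or non-split (`ord Δ` even) — `tam_blind_p`.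
* At `2`: the translate `M = (1, m, 1, 2) • E′_m = [2, m − 1, 4, 0, 4(m − 1)]` is in Tate's normal form.
  `m ≡ 1 (4)`: `4 ∣ a₂`, `8 ∣ a₄`, `16 ∣ a₆`, `a₃/4 = 1` odd ⟹ type IV*, residual quadratic `Y² + Y − (m − 1)/4`
  with a root in `𝔽₂` iff `8 ∣ m − 1`: `c₂ = 3` (`m ≡ 1 (8)`) / `c₂ = 1` (`m ≡ 5 (8)`);
  `m ≡ 3 (4)`: Step 6 with cubic `T³ + ((m − 1)/2) T² + (m − 1)/2 ≡ T³ + T² + 1` — separable, NO root in `𝔽₂`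
  ⟹ type I₀*, `c₂ = 1 + #roots = 1` — `tam_blind_two_*`.
* `c_v = 1` off `{2, p}`; `∏ᶠ = c₂ · c_p` (`tamagawaProduct_blindInt`, `tamagawaProduct_blindCurve`).

Hence `blindFamilyTamagawaLaw_holds`, and with PART B's `blindFamilyTorsionLaw_holds` the support row
**E-an-103 `BlindFamilyLocalTerms`** (`blindFamilyLocalTerms_holds`, via an's `blindFamilyLocalTerms_of_laws`).
What this is NOT: no statement about the Manin constant of `E′_m` (that is E-an-102 / the crux); `--supports 22967`.
BSD is not proved by this; Manin's conjecture is not proved by this.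

References: [Tate1975] §7–8; [Silverman1994] IV.9.4 Steps 2, 6, 8 and Table 4.1; [SilvermanAEC2009] VII.1 Rem. 1.1,
VII.5 Prop. 5.1; [CremonaAlgorithms1997] §3.2.
-/

set_option autoImplicit false
-- lint-debt: the directory name repeats the summit name (sibling precedent `ManinLocalTwoThreeBlindFamilyTorsion.lean`)
set_option linter.dupNamespace false

noncomputable section

open scoped Classical NumberField

open IsLocalRing IsDedekindDomain Rat.HeightOneSpectrum WeierstrassCurve
  Literature.NumberTheory.EllipticCurves Literature.NumberTheory.GaloisRepresentations
  Literature.NumberTheory.DiophantineGeometry Literature.NumberTheory.DiophantineGeometry.TateAlgorithm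
  Summit.BirchSwinnertonDyer.BirchSwinnertonDyer.Rank2Observatory.Tam
  Summit.BirchSwinnertonDyer.BirchSwinnertonDyer.Rank2Observatory.Tate
  Summit.BirchSwinnertonDyer.Rank1Residual.ManinAdditive
  Summit.BirchSwinnertonDyer.Rank1Residual.ManinAdditive.ShimuraLedger
  Summit.BirchSwinnertonDyer.Rank1Residual.ManinAdditive.BlindFamilyDescent

namespace Summit.BirchSwinnertonDyer.BirchSwinnertonDyer.Theorems.ManinLocalTwoThree

/-! ### §1 The two integer equations and their invariants -/

/-- `Δ[0, −2m, 0, m² + 4, 0] = −256 (m² + 4)²` on the integer equation. [cite: SilvermanAEC2009, III.1] -/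
theorem blindInt_Δ (m : ℤ) :
    (⟨0, -2 * m, 0, m ^ 2 + 4, 0⟩ : WeierstrassCurve ℤ).Δ = -256 * (m ^ 2 + 4) ^ 2 := by
  simp only [WeierstrassCurve.Δ, WeierstrassCurve.b₂, WeierstrassCurve.b₄, WeierstrassCurve.b₆,
    WeierstrassCurve.b₈]
  ring

/-- `c₄[0, −2m, 0, m² + 4, 0] = 16 (m² − 12)` on the integer equation. [cite: SilvermanAEC2009, III.1] -/
theorem blindInt_c₄ (m : ℤ) :
    (⟨0, -2 * m, 0, m ^ 2 + 4, 0⟩ : WeierstrassCurve ℤ).c₄ = 16 * (m ^ 2 - 12) := by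
  simp only [WeierstrassCurve.c₄, WeierstrassCurve.b₂, WeierstrassCurve.b₄]
  ring

/-- The Tate translate at `2`: `(1, m, 1, 2) • [0, −2m, 0, m² + 4, 0] = [2, m − 1, 4, 0, 4(m − 1)]`.
[cite: SilvermanAEC2009, III.1 Table 3.1] -/
theorem blindInt_translate (m : ℤ) :
    (⟨2, m - 1, 4, 0, 4 * (m - 1)⟩ : WeierstrassCurve ℤ) =
      (⟨1, m, 1, 2⟩ : VariableChange ℤ) • (⟨0, -2 * m, 0, m ^ 2 + 4, 0⟩ : WeierstrassCurve ℤ) := by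
  ext <;> simp [variableChange_a₁, variableChange_a₂, variableChange_a₃, variableChange_a₄,
    variableChange_a₆] <;> ring

/-- `Δ[2, m − 1, 4, 0, 4(m − 1)] = −256 (m² + 4)²` (the translate has the same discriminant). [cite: SilvermanAEC2009, III.1] -/
theorem blindTranslate_Δ (m : ℤ) :
    (⟨2, m - 1, 4, 0, 4 * (m - 1)⟩ : WeierstrassCurve ℤ).Δ = -256 * (m ^ 2 + 4) ^ 2 := by
  simp only [WeierstrassCurve.Δ, WeierstrassCurve.b₂, WeierstrassCurve.b₄, WeierstrassCurve.b₆,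
    WeierstrassCurve.b₈]
  ring

/-- The blind curve is the base change of its integer equation. [folklore] -/
theorem blindCurve_eq_baseChange (m : ℤ) :
    blindCurve m = (⟨0, -2 * m, 0, m ^ 2 + 4, 0⟩ : WeierstrassCurve ℤ).baseChange ℚ := by
  rw [blindCurve_eq_intCast]
  ext <;> simp [WeierstrassCurve.baseChange, WeierstrassCurve.map]

/-- `2⁸ ∥ −256 (m² + 4)²` for odd `m`. [folklore] -/
theorem two_pow_eight_exact {m : ℤ} (hm : Odd m) :
    (2 : ℤ) ^ 8 ∣ -256 * (m ^ 2 + 4) ^ 2 ∧ ¬ (2 : ℤ) ^ (8 + 1) ∣ -256 * (m ^ 2 + 4) ^ 2 := by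
  refine ⟨⟨-(m ^ 2 + 4) ^ 2, by ring⟩, fun h => ?_⟩
  obtain ⟨j, hj⟩ := odd_sq_add_four hm
  rw [hj, show (-256 : ℤ) * (2 * j + 1) ^ 2 = 2 ^ 8 * (-(2 * j + 1) ^ 2) by ring, pow_succ] at h
  have h2 : (2 : ℤ) ∣ -(2 * j + 1) ^ 2 := (mul_dvd_mul_iff_left (by norm_num)).mp h
  have : (2 : ℤ) ∣ (2 * j + 1) ^ 2 := (dvd_neg).mp h2
  have h' := Int.prime_two.dvd_of_dvd_pow this
  omega

/-! ### §2 The multiplicative place `p = m² + 4`: `c_p = 2` -/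

/-- For odd `m`, the odd number `p = m² + 4` does not divide `256`. [folklore] -/
theorem natAbs_sq_add_four_not_dvd_256 {m : ℤ} (hm : Odd m) (hp : Nat.Prime (m ^ 2 + 4).natAbs) :
    ¬ ((((m ^ 2 + 4).natAbs : ℕ) : ℤ)) ∣ 256 := by
  intro h
  have h' : (m ^ 2 + 4).natAbs ∣ 2 ^ 8 := by exact_mod_cast Int.natAbs_dvd_natAbs.mpr h
  have h2 := (Nat.prime_dvd_prime_iff_eq hp Nat.prime_two).mp (hp.dvd_of_dvd_pow h')
  obtain ⟨j, hj⟩ := odd_sq_add_four hm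
  have hpos : 0 < m ^ 2 + 4 := by positivity
  have hpz : (((m ^ 2 + 4).natAbs : ℕ) : ℤ) = m ^ 2 + 4 := Int.natAbs_of_nonneg hpos.le
  omega

/-- **`c_p(E′_m) = 2` at `p = m² + 4`** (odd `m`, `p` prime): `p ∤ c₄ = 16(m² − 12)` and `p² ∥ Δ = −2⁸p²`, so the
integer equation is minimal at `p` with multiplicative reduction and `ord_p Δ_min = 2`; split gives `c = ord Δ = 2`,
non-split gives `c = 2` because `ord Δ` is even. [cite: Silverman1994, IV.9.4 Step 2] [cite: SilvermanAEC2009, VII.5 Prop. 5.1(b)] -/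
theorem tam_blind_p {m : ℤ} (hm : Odd m) (hp : Nat.Prime (m ^ 2 + 4).natAbs)
    (v : HeightOneSpectrum (𝓞 ℚ)) (hv : natGenerator v = (m ^ 2 + 4).natAbs) :
    tam ⟨0, -2 * m, 0, m ^ 2 + 4, 0⟩ v = 2 := by
  set p : ℕ := (m ^ 2 + 4).natAbs with hpdef
  set W₀ : WeierstrassCurve ℤ := ⟨0, -2 * m, 0, m ^ 2 + 4, 0⟩ with hW₀
  haveI : Fact p.Prime := ⟨hp⟩
  have hpos : 0 < m ^ 2 + 4 := by positivity
  have hpz : (p : ℤ) = m ^ 2 + 4 := Int.natAbs_of_nonneg hpos.le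
  have h256 : ¬ (p : ℤ) ∣ 256 := natAbs_sq_add_four_not_dvd_256 hm hp
  have hΔ : W₀.Δ = (p : ℤ) ^ 2 * (-256) := by rw [hW₀, blindInt_Δ, hpz]; ring
  have hc4 : ¬ (p : ℤ) ∣ W₀.c₄ := by
    intro h
    rw [hW₀, blindInt_c₄] at h
    have h16 : (p : ℤ) ∣ 16 * (m ^ 2 + 4) := by rw [← hpz]; exact Dvd.intro_left _ rfl
    have := dvd_sub h16 h
    rw [show (16 : ℤ) * (m ^ 2 + 4) - 16 * (m ^ 2 - 12) = 256 by ring] at this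
    exact h256 this
  have hΔ1 : (p : ℤ) ∣ W₀.Δ := by rw [hΔ, pow_two, mul_assoc]; exact dvd_mul_right _ _
  have hΔ2 : (p : ℤ) ^ 2 ∣ W₀.Δ := by rw [hΔ]; exact dvd_mul_right _ _
  have hΔ3 : ¬ (p : ℤ) ^ (2 + 1) ∣ W₀.Δ := by
    rw [hΔ, pow_succ]
    intro h
    have hp0 : (p : ℤ) ^ 2 ≠ 0 := pow_ne_zero _ (by exact_mod_cast hp.ne_zero)
    have := (mul_dvd_mul_iff_left hp0).mp h
    exact h256 ((dvd_neg).mp this)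
  have hΔ0 : W₀.Δ ≠ 0 := fun h0 => hΔ3 (h0 ▸ dvd_zero _)
  haveI hE : (W₀.baseChange ℚ).IsElliptic := WeierstrassCurve.isElliptic_baseChange_int _ hΔ0
  have hmin : (W₀.baseChange ℚ).IsMinimalAt v := isMinimalAt_int_of_not_dvd_c₄ hv hc4
  have hord : (W₀.baseChange ℚ).ordMinimalDiscriminant v = 2 :=
    ordMinimalDiscriminant_int_eq hv hmin hΔ2 hΔ3
  dsimp only [tam]
  by_cases hs : (W₀.baseChange ℚ).HasSplitMultiplicativeReductionAt v
  · rw [localTamagawaNumber_eq_ordMinimalDiscriminant_of_hasSplitMultiplicativeReductionAt v _ hs, hord]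
  · have key := localTamagawaNumber_of_hasNonsplitMultiplicativeReductionAt_holds v (W₀.baseChange ℚ)
      (hasMultiplicativeReductionAt_int hv hΔ1 hc4) hs
    rw [hord, if_pos even_two] at key
    exact key

/-! ### §3 The additive place `2`: IV* (`m ≡ 1 (4)`, `c₂ ∈ {3, 1}` by `m mod 8`) and I₀* (`m ≡ 3 (4)`, `c₂ = 1`) -/

/-- The translate's discriminant is nonzero. [folklore] -/
theorem blindTranslate_Δ_ne_zero (m : ℤ) :
    (⟨2, m - 1, 4, 0, 4 * (m - 1)⟩ : WeierstrassCurve ℤ).Δ ≠ 0 := by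
  rw [blindTranslate_Δ]
  have : 0 < m ^ 2 + 4 := by positivity
  exact mul_ne_zero (by norm_num) (pow_ne_zero _ this.ne')

/-- **`c₂(E′_m) = 3` for `m ≡ 1 (mod 8)`**: on the translate `[2, m − 1, 4, 0, 4(m − 1)]`, `2 ∣ a₁`, `4 ∣ a₂`, `4 ∣ a₃`,
`8 ∣ a₄`, `16 ∣ a₆`, `(a₃/4)² + 4 (a₆/16) = 1 + (m − 1)/4` odd, `2⁸ ∥ Δ` — type IV* — and `Y = 0` is a root of
`Y² + Y − (m − 1)/4 (mod 2)`: index `3`. [cite: Tate1975, §8] [cite: Silverman1994, IV.9.4 Step 8] -/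
theorem tam_blind_two_of_emod_eight_eq_one {m : ℤ} (hm8 : m % 8 = 1)
    (v : HeightOneSpectrum (𝓞 ℚ)) (hv : natGenerator v = 2)
    (hmin : ((⟨0, -2 * m, 0, m ^ 2 + 4, 0⟩ : WeierstrassCurve ℤ).baseChange ℚ).IsMinimalAt v) :
    tam ⟨0, -2 * m, 0, m ^ 2 + 4, 0⟩ v = 3 := by
  obtain ⟨k, hk⟩ : ∃ k, m = 8 * k + 1 := ⟨m / 8, by omega⟩
  have hodd : Odd m := ⟨4 * k, by omega⟩
  obtain ⟨h8, h9⟩ := two_pow_eight_exact hodd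
  refine tam_eq_index_intModel v hv _ _ ⟨1, m, 1, 2⟩ rfl (blindInt_translate m) hmin
    (blindTranslate_Δ_ne_zero m) fun ε hε hpε => ?_
  refine index_IVstar_intCast_eq_three (K := v.adicCompletion ℚ)
    (M := (⟨2, m - 1, 4, 0, 4 * (m - 1)⟩ : WeierstrassCurve ℤ)) Nat.prime_two hε hpε
    ?_ ?_ ?_ ?_ ?_ ?_ (n := 8) ?_ ?_ (m := 0) ?_
  · norm_num
  · subst hk; norm_num; exact ⟨2 * k, by ring⟩
  · norm_num
  · norm_num
  · subst hk; norm_num; exact ⟨2 * k, by ring⟩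
  · subst hk; norm_num; omega
  · rw [blindTranslate_Δ]; exact_mod_cast h8
  · rw [blindTranslate_Δ]; exact_mod_cast h9
  · subst hk; norm_num; omega

/-- **`c₂(E′_m) = 1` for `m ≡ 5 (mod 8)`**: the same IV* normal form, but `Y² + Y − (m − 1)/4` has NO root modulo `2`
(`(m − 1)/4` odd): index `1`. [cite: Tate1975, §8] [cite: Silverman1994, IV.9.4 Step 8] -/
theorem tam_blind_two_of_emod_eight_eq_five {m : ℤ} (hm8 : m % 8 = 5)
    (v : HeightOneSpectrum (𝓞 ℚ)) (hv : natGenerator v = 2)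
    (hmin : ((⟨0, -2 * m, 0, m ^ 2 + 4, 0⟩ : WeierstrassCurve ℤ).baseChange ℚ).IsMinimalAt v) :
    tam ⟨0, -2 * m, 0, m ^ 2 + 4, 0⟩ v = 1 := by
  obtain ⟨k, hk⟩ : ∃ k, m = 8 * k + 5 := ⟨m / 8, by omega⟩
  have hsurj := fun y => exists_nat_residue_eq v y
  rw [hv] at hsurj
  refine tam_eq_index_intModel v hv _ _ ⟨1, m, 1, 2⟩ rfl (blindInt_translate m) hmin
    (blindTranslate_Δ_ne_zero m) fun ε hε hpε => ?_
  refine index_IVstar_intCast_eq_one (K := v.adicCompletion ℚ)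
    (M := (⟨2, m - 1, 4, 0, 4 * (m - 1)⟩ : WeierstrassCurve ℤ)) Nat.prime_two hε hpε
    ?_ ?_ ?_ ?_ ?_ hsurj ?_
  · norm_num
  · subst hk; norm_num; exact ⟨2 * k + 1, by ring⟩
  · norm_num
  · norm_num
  · subst hk; norm_num; exact ⟨2 * k + 1, by ring⟩
  · intro w hw
    subst hk
    interval_cases w <;> norm_num <;> omega

/-- **`c₂(E′_m) = 1` for `m ≡ 3 (mod 4)`**: on the translate, `2 ∣ a₁, a₂`, `4 ∣ a₃, a₄`, `8 ∣ a₆` (Step 6) with cubic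
`T³ + ((m − 1)/2) T² + (m − 1)/2 ≡ T³ + T² + 1 (mod 2)` — discriminant odd (separable: type I₀*) and NO root in `𝔽₂`:
index `1 + #roots = 1`. [cite: Tate1975, §7 (case 6)] [cite: Silverman1994, IV.9.4 Step 6] -/
theorem tam_blind_two_of_emod_four_eq_three {m : ℤ} (hm4 : m % 4 = 3)
    (v : HeightOneSpectrum (𝓞 ℚ)) (hv : natGenerator v = 2)
    (hmin : ((⟨0, -2 * m, 0, m ^ 2 + 4, 0⟩ : WeierstrassCurve ℤ).baseChange ℚ).IsMinimalAt v) :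
    tam ⟨0, -2 * m, 0, m ^ 2 + 4, 0⟩ v = 1 := by
  obtain ⟨k, hk⟩ : ∃ k, m = 4 * k + 3 := ⟨m / 4, by omega⟩
  have hodd : Odd m := ⟨2 * k + 1, by omega⟩
  obtain ⟨h8, h9⟩ := two_pow_eight_exact hodd
  have hsurj := fun y => exists_nat_residue_eq v y
  rw [hv] at hsurj
  refine tam_eq_index_intModel v hv _ _ ⟨1, m, 1, 2⟩ rfl (blindInt_translate m) hmin
    (blindTranslate_Δ_ne_zero m) fun ε hε hpε => ?_
  set M : WeierstrassCurve ℤ := ⟨2, m - 1, 4, 0, 4 * (m - 1)⟩ with hM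
  have hA2 : M.a₂ / ((2 : ℕ) : ℤ) ^ 1 = 2 * k + 1 := by rw [hM, hk]; norm_num; omega
  have hB4 : M.a₄ / ((2 : ℕ) : ℤ) ^ 2 = 0 := by rw [hM]; norm_num
  have hB6 : M.a₆ / ((2 : ℕ) : ℤ) ^ 3 = 2 * k + 1 := by rw [hM, hk]; norm_num; omega
  set P : ℕ → Bool := fun w => decide (((2 : ℕ) : ℤ) ∣ (w : ℤ) ^ 3 +
      M.a₂ / ((2 : ℕ) : ℤ) ^ 1 * (w : ℤ) ^ 2 + M.a₄ / ((2 : ℕ) : ℤ) ^ 2 * w + M.a₆ / ((2 : ℕ) : ℤ) ^ 3) with hP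
  have key := index_Istar_zero_intCast_eq (K := v.adicCompletion ℚ) (M := M) Nat.prime_two hε hpε
    (by rw [hM]; norm_num) (by rw [hM, hk]; norm_num; exact ⟨2 * k + 1, by ring⟩) (by rw [hM]; norm_num)
    (by rw [hM]; norm_num) (by rw [hM, hk]; norm_num; exact ⟨2 * k + 1, by ring⟩)
    (by
      rw [hA2, hB4, hB6, disc3]
      rw [show (2 * k + 1) ^ 2 * (0 : ℤ) ^ 2 - 4 * 0 ^ 3 - 4 * (2 * k + 1) ^ 3 * (2 * k + 1) -
          27 * (2 * k + 1) ^ 2 + 18 * (2 * k + 1) * 0 * (2 * k + 1) =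
          2 * (-(2 * (2 * k + 1) ^ 4 + 54 * k ^ 2 + 54 * k + 14)) + 1 by ring]
      omega)
    (n := 8) (by rw [hM, blindTranslate_Δ]; exact_mod_cast h8) (by rw [hM, blindTranslate_Δ]; exact_mod_cast h9)
    hsurj P (fun w => by rw [hP, decide_eq_true_iff])
  rw [key]
  have hP0 : P 0 = false := by
    rw [hP, decide_eq_false_iff_not, hA2, hB4, hB6]; norm_num
  have hP1 : P 1 = false := by
    rw [hP, decide_eq_false_iff_not, hA2, hB4, hB6]; norm_num; omega
  simp [List.range_succ, hP0, hP1]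

/-! ### §4 Assembly: `∏ᶠ_v c_v = c₂ · c_p` -/

/-- **`∏_ℓ c_ℓ = 2 · c₂` on the integer equation** (odd `m`, `p = m² + 4` prime, the equation globally minimal):
`c_v = 1` off `{2, p}` (`v ∤ Δ = −2⁸p²`), `c_p = 2` (§2), `c₂ = 3 / 1 / 1` on `m ≡ 1 / 5 (8)`, `m ≡ 3 (4)` (§3).
[cite: Silverman1994, IV.9.4] [cite: SilvermanAEC2009, VII.5 Prop. 5.1(a)] -/
theorem tamagawaProduct_blindInt {m : ℤ} (hm : Odd m) (hp : Nat.Prime (m ^ 2 + 4).natAbs)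
    (hGM : ((⟨0, -2 * m, 0, m ^ 2 + 4, 0⟩ : WeierstrassCurve ℤ).baseChange ℚ).IsGloballyMinimal) :
    ((⟨0, -2 * m, 0, m ^ 2 + 4, 0⟩ : WeierstrassCurve ℤ).baseChange ℚ).tamagawaProduct =
      2 * (if m % 8 = 1 then 3 else 1) := by
  set p : ℕ := (m ^ 2 + 4).natAbs with hpdef
  set W₀ : WeierstrassCurve ℤ := ⟨0, -2 * m, 0, m ^ 2 + 4, 0⟩ with hW₀
  have hpos : 0 < m ^ 2 + 4 := by positivity
  have hpz : (p : ℤ) = m ^ 2 + 4 := Int.natAbs_of_nonneg hpos.le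
  have hp2 : (2 : ℕ) ≠ p := by
    intro h
    obtain ⟨j, hj⟩ := odd_sq_add_four hm
    rw [← h] at hpz
    push_cast at hpz
    omega
  have hΔ0 : W₀.Δ ≠ 0 := by
    rw [hW₀, blindInt_Δ]; exact mul_ne_zero (by norm_num) (pow_ne_zero _ hpos.ne')
  haveI hE : (W₀.baseChange ℚ).IsElliptic := WeierstrassCurve.isElliptic_baseChange_int _ hΔ0
  -- `c_v = 1` off `{2, p}`
  have hoff : ∀ v : HeightOneSpectrum (𝓞 ℚ), natGenerator v ∉ [2, p] → tam W₀ v = 1 := by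
    intro v hv
    refine tam_eq_one_of_not_dvd (W₀ := W₀) (v := v) rfl fun hd => hv ?_
    have hq := prime_natGenerator v
    rw [hW₀, blindInt_Δ, ← hpz] at hd
    have hd' : natGenerator v ∣ 256 * p ^ 2 := by
      have := Int.natAbs_dvd_natAbs.mpr hd
      simpa [Int.natAbs_mul, Int.natAbs_pow] using this
    rcases (Nat.Prime.dvd_mul hq).mp hd' with h | h
    · exact List.mem_cons.mpr (Or.inl ((Nat.prime_dvd_prime_iff_eq hq Nat.prime_two).mp
        (hq.dvd_of_dvd_pow (n := 8) (by norm_num; exact h))))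
    · exact List.mem_cons.mpr (Or.inr (List.mem_singleton.mpr
        ((Nat.prime_dvd_prime_iff_eq hq hp).mp (hq.dvd_of_dvd_pow h))))
  have key : (W₀.baseChange ℚ).tamagawaProduct = tam W₀ (pl 2) * tam W₀ (pl p) := by
    change ∏ᶠ v, tam W₀ v = _
    rw [finprod_eq_prod_map_pl (tam W₀) [2, p] (by simp [hp2]) (by
      intro q hq
      simp only [List.mem_cons, List.not_mem_nil, or_false] at hq
      rcases hq with rfl | rfl
      exacts [Nat.prime_two, hp]) hoff]
    simp
  rw [key, tam_blind_p hm hp (pl p) (natGenerator_pl hp), mul_comm]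
  have hv2 : natGenerator (pl 2) = 2 := natGenerator_pl Nat.prime_two
  have hmin : (W₀.baseChange ℚ).IsMinimalAt (pl 2) := hGM.isMinimal _
  have hm8 : m % 8 = 1 ∨ m % 8 = 5 ∨ m % 4 = 3 := by obtain ⟨j, hj⟩ := hm; omega
  rcases hm8 with h | h | h
  · rw [if_pos h, tam_blind_two_of_emod_eight_eq_one h _ hv2 hmin]
  · rw [if_neg (by omega), tam_blind_two_of_emod_eight_eq_five h _ hv2 hmin]
  · rw [if_neg (by omega), tam_blind_two_of_emod_four_eq_three h _ hv2 hmin]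

/-- **The Tamagawa product of the blind curve**: `∏_ℓ c_ℓ(E′_m) = 2 · (3 if m ≡ 1 (8), else 1)` for odd `m` with
`m² + 4` prime. [cite: Silverman1994, IV.9.4 and Table 4.1] -/
theorem tamagawaProduct_blindCurve {m : ℤ} (hm : Odd m) (hp : Nat.Prime (m ^ 2 + 4).natAbs) :
    (blindCurve m).tamagawaProduct = 2 * (if m % 8 = 1 then 3 else 1) := by
  have hGM := isGloballyMinimal_blindCurve hm
  rw [blindCurve_eq_baseChange] at hGM ⊢
  exact tamagawaProduct_blindInt hm hp hGM

/-- **E-an-103♯ `BlindFamilyTamagawaLaw` (PROVED BY NAME).**  For odd `m` with `m² + 4` prime,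
`∏_ℓ c_ℓ(E′_m) = 2 · (3 if m ≡ 1 (mod 8), else 1)` — Kodaira IV* (`m ≡ 1 (4)`: split iff `m ≡ 1 (8)`) resp. I₀*
(`m ≡ 3 (4)`) at `2`, I₂ at `p = m² + 4`. [cite: Silverman1994, IV.9.4 Steps 2, 6, 8 and Table 4.1] [cite: Tate1975, §§7–8] -/
theorem blindFamilyTamagawaLaw_holds : BlindFamilyTamagawaLaw :=
  fun _m hm hp => tamagawaProduct_blindCurve hm hp

/-- **E-an-103 `BlindFamilyLocalTerms` (PROVED BY NAME)** — the support row: for odd `|m| ≥ 3` with `m² + 4` prime,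
`#E′_m(ℚ)_tors = 2` (E-an-103♭, `blindFamilyTorsionLaw_holds`) and `∏ c_ℓ(E′_m) = 2 · c₂` with `c₂` odd (E-an-103♯),
assembled by an's `blindFamilyLocalTerms_of_laws`. [cite: Silverman1994, IV.9.4] [cite: Knapp1993, Ch. V Thm. 5.1(c)] -/
theorem blindFamilyLocalTerms_holds : BlindFamilyLocalTerms :=
  blindFamilyLocalTerms_of_laws blindFamilyTorsionLaw_holds blindFamilyTamagawaLaw_holds

end Summit.BirchSwinnertonDyer.BirchSwinnertonDyer.Theorems.ManinLocalTwoThree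

end
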